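import Summits.CriticalPhenomena.PercolationContinuityZ3.Theorems.PercNearOneGluingNoHeavyPcintBSMGreen
import HarnessLib

/-!
# PCINT lane, PHASE 5 (block-renewal second moment), step 8a: the local count at time offset zero and the offset boxes

Cell `prim-pcint`, seat `prim-pcint-1` (gen 14); memo `run/shared/lean/prim/pcint/T-FIBRE-ROUTE.md` §PHASE 5.

At time offset `0` the local shared count of two blocks `(σ, a), (σ', a')` at transverse offset `y` splits as
`Rloc = S + 𝟙[a = a' ∧ pend σ = pend σ' + y]` (**`BSM.Rloc_zero`**; `S` = shared transverse edge keys), because time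
keys and transverse keys never coincide.  A nonzero local count forces time offset `0` and a transverse offset that is a
difference of two key vertices (`BSM.exists_of_Rloc_ne_zero`); when piece endpoints and key vertices lie in the cube
(`BSM.Cube`, `BSM.KeyCube`) the rewards therefore vanish outside `{0} × [-2,2]^t` (**`BSM.mem_box_of_Rloc_ne_zero`**),
and one block later the transverse offset lies in `[-4,4]^t` (`BSM.mem_Box4`).
-/

noncomputable section

namespace Summit.CriticalPhenomena.PercolationContinuityZ3.Theorems.Pcint.BSM

open Finset OSM

variable {t k np : ℕ}

/-! ### The local count at time offset zero -/

/-- Keys of transverse steps carry a transverse axis. -/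
theorem snd_of_mem_tedges : ∀ (σ : List (Fin t × Bool)) (u : Fin t → ℤ) (q : LKey t k),
    q ∈ tedges k u σ → ∃ i, q.2 = Sum.inl i
  | [], u, q, h => by simp [tedges] at h
  | x :: σ, u, q, h => by
    rw [tedges, mem_insert] at h
    rcases h with rfl | h
    · refine ⟨x.1, ?_⟩; split_ifs <;> rfl
    · exact snd_of_mem_tedges σ _ q h

/-- **The transverse shared count** of two pieces at transverse offset `y`. -/
def S (pc : Fin np → List (Fin t × Bool)) (k : ℕ) (y : Fin t → ℤ) (σ σ' : Fin np) : ℕ :=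
  (tedges k 0 (pc σ) ∩ (tedges k 0 (pc σ')).map (shiftE y)).card

/-- **The local count at time offset zero**: transverse shared keys plus the shared time step. -/
theorem Rloc_zero (pc : Fin np → List (Fin t × Bool)) (y : Fin t → ℤ) (σ σ' : Fin np) (a a' : Fin k) :
    Rloc pc ((0 : Fin k → ℤ), y) (σ, a) (σ', a') =
      S pc k y σ σ' + (if a = a' ∧ pend (pc σ) = pend (pc σ') + y then 1 else 0) := by
  rw [Rloc, if_pos rfl, S, Eloc, Eloc, Finset.map_insert]
  set A := tedges k 0 (pc σ) with hA
  set A' := (tedges k 0 (pc σ')).map (shiftE y) with hA'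
  set z₀ : LKey t k := (pend (pc σ), Sum.inr a) with hz₀
  have hz₁ : shiftE y ((pend (pc σ'), Sum.inr a') : LKey t k) = (pend (pc σ') + y, Sum.inr a') := rfl
  rw [hz₁]
  set z₁ : LKey t k := (pend (pc σ') + y, Sum.inr a') with hz₁'
  -- time keys are not transverse keys
  have hz₀A' : z₀ ∉ A' := by
    intro h
    obtain ⟨q, hq, hq'⟩ := mem_map.1 h
    obtain ⟨i, hi⟩ := snd_of_mem_tedges _ _ q hq
    have := congr_arg Prod.snd hq'
    simp [shiftE, hi, hz₀] at this
  have hz₀A : z₀ ∉ A := by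
    intro h; obtain ⟨i, hi⟩ := snd_of_mem_tedges _ _ _ h; simp [hz₀] at hi
  have hz₁A : z₁ ∉ A := by
    intro h; obtain ⟨i, hi⟩ := snd_of_mem_tedges _ _ _ h; simp [hz₁'] at hi
  have hiff : (z₀ = z₁) ↔ (a = a' ∧ pend (pc σ) = pend (pc σ') + y) := by
    rw [hz₀, hz₁', Prod.ext_iff]
    simp only [Sum.inr.injEq]
    tauto
  by_cases h : z₀ = z₁
  · have hset : insert z₀ A ∩ insert z₁ A' = insert z₀ (A ∩ A') := by
      ext q
      simp only [mem_inter, mem_insert]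
      constructor
      · rintro ⟨h1 | h1, h2 | h2⟩
        · exact Or.inl h1
        · exact Or.inl h1
        · rw [h2, ← h] at h1; exact absurd h1 hz₀A
        · exact Or.inr ⟨h1, h2⟩
      · rintro (rfl | ⟨h1, h2⟩)
        · exact ⟨Or.inl rfl, Or.inl h⟩
        · exact ⟨Or.inr h1, Or.inr h2⟩
    rw [hset, card_insert_of_notMem (fun hh => hz₀A (mem_inter.1 hh).1), if_pos (hiff.1 h)]
  · have hset : insert z₀ A ∩ insert z₁ A' = A ∩ A' := by
      ext q
      simp only [mem_inter, mem_insert]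
      constructor
      · rintro ⟨h1 | h1, h2 | h2⟩
        · exact absurd (h1.symm.trans h2) h
        · exact absurd (h1 ▸ h2 : z₀ ∈ A') hz₀A'
        · exact absurd (h2 ▸ h1 : z₁ ∈ A) hz₁A
        · exact ⟨h1, h2⟩
      · rintro ⟨h1, h2⟩
        exact ⟨Or.inr h1, Or.inr h2⟩
    rw [hset, if_neg (fun hh => h (hiff.2 hh)), add_zero]

/-- A nonzero local count forces time offset zero … -/
theorem fst_eq_zero_of_Rloc_ne_zero (pc : Fin np → List (Fin t × Bool)) {o : Off t k} {b b' : Blk np k}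
    (h : Rloc pc o b b' ≠ 0) : o.1 = 0 := by
  by_contra h1
  rw [Rloc, if_neg h1] at h
  exact h rfl

/-- … and a transverse offset that is a difference of two local key vertices. -/
theorem exists_of_Rloc_ne_zero (pc : Fin np → List (Fin t × Bool)) {o : Off t k} {b b' : Blk np k}
    (h : Rloc pc o b b' ≠ 0) : ∃ q ∈ Eloc pc b, ∃ q' ∈ Eloc pc b', q.1 = q'.1 + o.2 := by
  rw [Rloc, if_pos (fst_eq_zero_of_Rloc_ne_zero pc h)] at h
  obtain ⟨z, hz⟩ := Finset.card_ne_zero.1 h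
  rw [mem_inter, mem_map] at hz
  obtain ⟨hz1, q', hq', hzq⟩ := hz
  exact ⟨z, hz1, q', hq', by rw [← hzq]; rfl⟩

/-! ### The box of relevant offsets -/

/-- The box `[-r, r]^t`. -/
def Box (t r : ℕ) : Finset (Fin t → ℤ) := Fintype.piFinset fun _ => Finset.Icc (-(r : ℤ)) r

/-- Membership in a box, coordinatewise. -/
theorem mem_Box {r : ℕ} {y : Fin t → ℤ} : y ∈ Box t r ↔ ∀ i, -(r : ℤ) ≤ y i ∧ y i ≤ r := by
  simp [Box, Fintype.mem_piFinset]

/-- The box `[-2, 2]^t` of transverse offsets at which two blocks can share keys. -/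
abbrev Ybox (t : ℕ) : Finset (Fin t → ℤ) := Box t 2

/-- Offsets after one more block stay in `[-4, 4]^t`. -/
theorem mem_Box4 {pc : Fin np → List (Fin t × Bool)} (hc : Cube pc) {y : Fin t → ℤ} (hy : y ∈ Ybox t) (σ σ' : Fin np) :
    y + (pend (pc σ') - pend (pc σ)) ∈ Box t 4 := by
  rw [mem_Box] at hy ⊢
  intro i
  have h1 := hy i
  simp only [Pi.add_apply, Pi.sub_apply]
  rcases hc σ i with h | h | h <;> rcases hc σ' i with h' | h' | h' <;> rw [h, h'] <;> constructor <;> push_cast <;> omega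

/-- **Key vertices in the cube**: every vertex of a local edge key has coordinates in `[-1, 1]`. -/
def KeyCube (pc : Fin np → List (Fin t × Bool)) (k : ℕ) : Prop :=
  ∀ σ, ∀ q ∈ tedges k 0 (pc σ), ∀ i, -1 ≤ q.1 i ∧ q.1 i ≤ 1

/-- Vertices of all local keys of a block lie in the cube. -/
theorem key_cube {pc : Fin np → List (Fin t × Bool)} (hc : Cube pc) (hkc : KeyCube pc k) (b : Blk np k)
    {q : LKey t k} (hq : q ∈ Eloc pc b) (i : Fin t) : -1 ≤ q.1 i ∧ q.1 i ≤ 1 := by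
  rw [Eloc, mem_insert] at hq
  rcases hq with rfl | hq
  · rcases hc b.1 i with h | h | h <;> simp only [h] <;> norm_num
  · exact hkc b.1 q hq i

/-- The rewards vanish outside `{0} × [-2,2]^t`. -/
theorem mem_box_of_Rloc_ne_zero {pc : Fin np → List (Fin t × Bool)} (hc : Cube pc) (hkc : KeyCube pc k)
    {o : Off t k} {b b' : Blk np k} (h : Rloc pc o b b' ≠ 0) :
    o ∈ (Ybox t).image (fun y => ((0 : Fin k → ℤ), y)) := by
  rw [mem_image]
  refine ⟨o.2, ?_, Prod.ext (fst_eq_zero_of_Rloc_ne_zero pc h).symm rfl⟩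
  obtain ⟨q, hq, q', hq', hqq⟩ := exists_of_Rloc_ne_zero pc h
  rw [mem_Box]
  intro i
  have h1 := key_cube hc hkc b hq i
  have h2 := key_cube hc hkc b' hq' i
  have : o.2 i = q.1 i - q'.1 i := by rw [hqq]; simp
  rw [this]
  push_cast
  constructor <;> linarith [h1.1, h1.2, h2.1, h2.2]

end Summit.CriticalPhenomena.PercolationContinuityZ3.Theorems.Pcint.BSM

end
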